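import Literature.AlgebraicGeometry.AbelianSchemes.PoincarePullbackStabilizerOfChar
import Literature.AlgebraicGeometry.AbelianSchemes.PoincarePullbackCharOfCount
import HarnessLib

/-!
# (K) for the dual-of-a-quotient: `hStab` from the point COUNT (road (R-ℂ) of record)

★ `PoincarePullbackStabilizerOfChar.hStab_of_hChar` reduces the stabiliser hypothesis `hStab` of the uniqueness theorem ★
`AbelianSchemeQuotientDualPairUnique` ([MumfordAV1970] §15 Thm. 1: the dual of `A/K` is `Â/K^⊥`) to the character step
`hChar`; ★ `PoincarePullbackCharOfCount` (B-p02 (g11)) proves `hChar` from a COUNT of the geometric points of `Â` whose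
Poincaré class dies on `A/K`.  This file composes the two, in both forms of the count:

* `hStab_of_stabilizer_of_ncard_le` — `K′ ⊆ Stab(𝒩₁)` (the input of the equivariant structure, ★
  `poincareStabilizerStructure`) + the count `#{b ∈ Â_s(Ω) : (π × b)^*𝒫 ≅ 𝒪} ≤ #{c | φ̂(c) ∈ K′}` at EVERY geometric point;
* `hStab_of_spread_of_ncard_le` — the same with the count at the points of ONE algebraically closed field `Ω₀` (`ℂ` on the
  Hecke-link line) plus the spreading hypothesis `hspread` («a constant section whose class dies over some non-empty `U`
  dies at some `Ω₀`-point», the (K4)/(K5-spread) brick).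

## References

* [MumfordAV1970] D. Mumford, *Abelian Varieties* (1970), §15 Thm. 1 (p. 143).
* [MilneAV2008] J. S. Milne, *Abelian Varieties* (2008), I §8 (pp. 36–37).
* [MumfordFogartyKirwan1994] D. Mumford, J. Fogarty, F. Kirwan, *GIT* (3rd ed.), Ch. 7 §2 Def. 7.1 (p. 129).
-/

noncomputable section

-- `(A.baseChange f).X = (Over.pullback f).obj A.X` / `(A.X ⊗ B.X).left = A.prodLeft B` hold by `rfl` only.
set_option backward.isDefEq.respectTransparency false

universe u

open CategoryTheory CategoryTheory.Limits AlgebraicGeometry MonoidalCategory CartesianMonoidalCategory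

open scoped MonObj

namespace Literature.AlgebraicGeometry.AbelianSchemes

namespace AbelianSchemeOver

open Literature.AlgebraicGeometry.RelativeSpec

variable {S : Scheme.{u}} (A : AbelianSchemeOver S)
  {Y : Scheme.{u}} (u : S ⟶ Y) (K : Subgroup A.Sections) [IsCommMonObj A.X] {n : ℕ}
  (hK : ∀ σ : K, (σ : A.Sections) ^ n = 1)
  [Finite K] [Y.IsSeparated] [IsSeparated (A.X.hom ≫ u)] [S.IsSeparated]
  (hcov : ∀ x : A.left, ∃ O : (A.translationActionOver u K).StableAffineOpens, x ∈ O.1)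
  [LocallyOfFiniteType (A.X.hom ≫ u)] [IsLocallyNoetherian Y]
  (hG : ∃ _ : GrpObj (A.quotientOver u K), IsMonHom (A.quotientMk u K hcov))
  (hsm : Smooth (A.quotientOver u K).hom) (hgc : GeometricallyConnected (A.quotientOver u K).hom)
  (D : A.DualPair) [IsAffine Y]
  (hfree : ∀ (Ω : Type u) [Field Ω] [IsAlgClosed Ω] (x : Spec (.of Ω) ⟶ A.left) (σ : K), σ ≠ 1 →
    x ≫ (A.translation (σ : A.Sections)).left ≠ x)
  (K' : Subgroup D.hat.Sections) [Finite K'] [IsSeparated (D.hat.X.hom ≫ u)]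
  (hcov' : ∀ x : D.hat.left, ∃ O : (D.hat.translationActionOver u K').StableAffineOpens, x ∈ O.1)
  {g : ℕ} (φ : LevelStructure g n D.hat)

/-- **`hStab` from `K′ ⊆ Stab(𝒩₁)` and the count at every geometric point.**  For `S` reduced and locally Noetherian,
`n` invertible on `S`, `hD`, a level-`n` structure `φ̂` on `Â`, `K′ ⊆ Stab(𝒩₁)` and
`#{b ∈ Â_s(Ω) : (1 × b)^*𝒩₁ ≅ 𝒪} ≤ #{c | φ̂(c) ∈ K′}` at every geometric point `s`: for all `f : T → S` and `a a′ : T → Â`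
over `f`, `(1 × a)^*𝒩₁ ≅ (1 × a′)^*𝒩₁ ⟹ a ≫ ψ̂ = a′ ≫ ψ̂` (★ `hStab_of_hChar` ∘ ★ `section_mem_of_stabilizer_of_ncard_le`).
[cite: MumfordAV1970, §15 Thm. 1 (p. 143)] [cite: MilneAV2008, I §8 (pp. 36–37)] -/
theorem hStab_of_stabilizer_of_ncard_le [IsReduced S] [IsLocallyNoetherian S] (hn : ∀ s : S, (n : S.residueField s) ≠ 0)
    (hD : Nonempty ((Scheme.Modules.pullback (DualPair.unitHatSlice D)).obj D.P ≅ SheafOfModules.unit _))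
    (hK'stab : ∀ k ∈ K', Nonempty
      ((Scheme.Modules.pullback ((A.quotientBy u K hcov hG hsm hgc).X ◁ D.hat.translation k).left).obj
          (A.poincarePullbackBundle u K hK hcov hG hsm hgc D hfree).L ≅
        (A.poincarePullbackBundle u K hK hcov hG hsm hgc D hfree).L))
    (hcard : ∀ ⦃Ω : Type u⦄ [Field Ω] [IsAlgClosed Ω] (s : Spec (.of Ω) ⟶ S),
      {b : D.hat.FibrePoints s | Nonempty ((Scheme.Modules.pullback
          ((A.quotientBy u K hcov hG hsm hgc).baseChangeToProd D.hat s b.left (Over.w b))).obj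
          (A.poincarePullbackBundle u K hK hcov hG hsm hgc D hfree).L ≅ SheafOfModules.unit _)}.Finite ∧
      {b : D.hat.FibrePoints s | Nonempty ((Scheme.Modules.pullback
          ((A.quotientBy u K hcov hG hsm hgc).baseChangeToProd D.hat s b.left (Over.w b))).obj
          (A.poincarePullbackBundle u K hK hcov hG hsm hgc D hfree).L ≅ SheafOfModules.unit _)}.ncard ≤
        {c : Fin g ⊕ Fin g → ZMod n | φ.section_ c ∈ K'}.ncard)
    {T : Scheme.{u}} (f : T ⟶ S) (a a' : T ⟶ D.hat.X.left) (ha : a ≫ D.hat.X.hom = f)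
    (ha' : a' ≫ D.hat.X.hom = f)
    (h : Nonempty ((Scheme.Modules.pullback ((A.quotientBy u K hcov hG hsm hgc).baseChangeToProd D.hat f a ha)).obj
        (A.poincarePullbackBundle u K hK hcov hG hsm hgc D hfree).L ≅
      (Scheme.Modules.pullback ((A.quotientBy u K hcov hG hsm hgc).baseChangeToProd D.hat f a' ha')).obj
        (A.poincarePullbackBundle u K hK hcov hG hsm hgc D hfree).L)) :
    a ≫ (D.hat.quotientMk u K' hcov').left = a' ≫ (D.hat.quotientMk u K' hcov').left :=
  A.hStab_of_hChar u K hK hcov hG hsm hgc D hfree K' hcov' φ hn hD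
    (fun c _ w _ b b' hb hb' hrel hbb' =>
      DualPair.section_mem_of_stabilizer_of_ncard_le (X := A.quotientBy u K hcov hG hsm hgc) D
        (A.mulNDesc u K hK hcov) hD K' φ hK'stab hcard c w b b' hb hb' hrel hbb')
    f a a' ha ha' h

/-- **`hStab` from the count at the points of ONE algebraically closed field `Ω₀` (road (R-ℂ)) plus spreading.**  As
`hStab_of_stabilizer_of_ncard_le`, with `K′` known to die on `A/K` at the `Ω₀`-points, the count at `Ω₀`-points only, and
`hspread`: a constant section `φ̂(c)` whose class dies over some non-empty `U → S` dies at some `Ω₀`-point of `S` (the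
(K4)/(K5-spread) brick). [cite: MumfordAV1970, §15 Thm. 1 (p. 143)] [cite: MilneAV2008, I §8 (pp. 36–37)] -/
theorem hStab_of_spread_of_ncard_le [IsReduced S] [IsLocallyNoetherian S] (hn : ∀ s : S, (n : S.residueField s) ≠ 0)
    (Ω₀ : Type u) [Field Ω₀] [IsAlgClosed Ω₀]
    (hD : Nonempty ((Scheme.Modules.pullback (DualPair.unitHatSlice D)).obj D.P ≅ SheafOfModules.unit _))
    (hK'triv : ∀ k ∈ K', ∀ (t : Spec (.of Ω₀) ⟶ S),
      Nonempty ((Scheme.Modules.pullback ((A.quotientBy u K hcov hG hsm hgc).baseChangeToProd D.hat t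
          (D.hat.restrict t k).left (Over.w _))).obj
        (A.poincarePullbackBundle u K hK hcov hG hsm hgc D hfree).L ≅ SheafOfModules.unit _))
    (hcard : ∀ (t : Spec (.of Ω₀) ⟶ S),
      {b : D.hat.FibrePoints t | Nonempty ((Scheme.Modules.pullback
          ((A.quotientBy u K hcov hG hsm hgc).baseChangeToProd D.hat t b.left (Over.w b))).obj
          (A.poincarePullbackBundle u K hK hcov hG hsm hgc D hfree).L ≅ SheafOfModules.unit _)}.Finite ∧
      {b : D.hat.FibrePoints t | Nonempty ((Scheme.Modules.pullback
          ((A.quotientBy u K hcov hG hsm hgc).baseChangeToProd D.hat t b.left (Over.w b))).obj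
          (A.poincarePullbackBundle u K hK hcov hG hsm hgc D hfree).L ≅ SheafOfModules.unit _)}.ncard ≤
        {c : Fin g ⊕ Fin g → ZMod n | φ.section_ c ∈ K'}.ncard)
    (hspread : ∀ (c : Fin g ⊕ Fin g → ZMod n) {U : Scheme.{u}} (w : U ⟶ S) [Nonempty U],
      Nonempty ((Scheme.Modules.pullback ((A.quotientBy u K hcov hG hsm hgc).baseChangeToProd D.hat w
          ((toUnit (Over.mk w) ≫ φ.section_ c : Over.mk w ⟶ D.hat.X)).left (Over.w _))).obj
        (A.poincarePullbackBundle u K hK hcov hG hsm hgc D hfree).L ≅ SheafOfModules.unit _) →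
      ∃ t : Spec (.of Ω₀) ⟶ S, Nonempty ((Scheme.Modules.pullback
        ((A.quotientBy u K hcov hG hsm hgc).baseChangeToProd D.hat t (D.hat.restrict t (φ.section_ c)).left
          (Over.w _))).obj
          (A.poincarePullbackBundle u K hK hcov hG hsm hgc D hfree).L ≅ SheafOfModules.unit _))
    {T : Scheme.{u}} (f : T ⟶ S) (a a' : T ⟶ D.hat.X.left) (ha : a ≫ D.hat.X.hom = f)
    (ha' : a' ≫ D.hat.X.hom = f)
    (h : Nonempty ((Scheme.Modules.pullback ((A.quotientBy u K hcov hG hsm hgc).baseChangeToProd D.hat f a ha)).obj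
        (A.poincarePullbackBundle u K hK hcov hG hsm hgc D hfree).L ≅
      (Scheme.Modules.pullback ((A.quotientBy u K hcov hG hsm hgc).baseChangeToProd D.hat f a' ha')).obj
        (A.poincarePullbackBundle u K hK hcov hG hsm hgc D hfree).L)) :
    a ≫ (D.hat.quotientMk u K' hcov').left = a' ≫ (D.hat.quotientMk u K' hcov').left :=
  A.hStab_of_hChar u K hK hcov hG hsm hgc D hfree K' hcov' φ hn hD
    (fun c _ w _ b b' hb hb' hrel hbb' =>
      DualPair.section_mem_of_spread_of_ncard_le (X := A.quotientBy u K hcov hG hsm hgc) D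
        (A.mulNDesc u K hK hcov) Ω₀ hD K' φ hK'triv hcard hspread c w b b' hb hb' hrel hbb')
    f a a' ha ha' h

end AbelianSchemeOver

end Literature.AlgebraicGeometry.AbelianSchemes

end
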